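import Summits.CriticalPhenomena.PercolationContinuityZ3.Theorems.PercNearOneGluingNoHeavyLowerTailSahiOneStepDefs
import Mathlib.Topology.UnitInterval
import Mathlib.Topology.Order.Basic
import HarnessLib

/-!
# One-step scheme: the functional `N_t` is continuous in the density vector — inequalities pass from the open cube to its boundary

Support file (prover prim-ineq-prove-3 gen 30; `--supports stmt-CriticalPhenomena-4575`; memo
`run/shared/lean/prim/prim-ineq-prove-3/PROOF-G30-SHIFTED-PARTNER.md` §5).  No definitions, no named facts, no sorries, no `native_decide`.

THEOREMS S′/SP (`…OppositeShifted`, `…ShiftedPartner`) are proved for INTERIOR density vectors `p ∈ (0,1)^ι` (their compressions divide by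
`pᵢqⱼ`).  Here: `continuous_ex_bernoulliWeight` — `p ↦ E_p f` is continuous (a polynomial); `continuous_osN` — so is `p ↦ N(p; H, f, g)`;
**`osN_nonneg_of_forall_interior`** — if `0 ≤ N(q; H, f, g)` for every interior `q`, then `0 ≤ N(p; H, f, g)` for EVERY `p ∈ [0,1]^ι`
(along the segment `q_s = (1−s)p + s/2`, `s ↓ 0`).  Hence every interior-density positivity statement about `osN` holds at all densities.
-/

noncomputable section

namespace Summit.CriticalPhenomena.PercolationContinuityZ3.Theorems

namespace SahiOneStep

open Literature.Combinatorics.Sahi2008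
open Literature.Probability.Percolation.DecisionTree (ind)
open Literature.Probability.Percolation.BHK2006 (weight)
open scoped Classical

variable {ι : Type*} [Fintype ι]

/-- `p ↦ E_p f = Σ_ω w_p(ω) f(ω)` is continuous on `[0,1]^ι`. [folklore] -/
theorem continuous_ex_bernoulliWeight (f : Set ι → ℝ) : Continuous (fun p : ι → unitInterval => ex (bernoulliWeight p) f) := by
  unfold ex bernoulliWeight weight
  refine continuous_finsetSum _ fun ω _ => (continuous_finsetProd _ fun e _ => ?_).mul continuous_const
  have hpe : Continuous (fun p : ι → unitInterval => (p e : ℝ)) := continuous_subtype_val.comp (continuous_apply e)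
  by_cases he : e ∈ ω
  · simp only [he, if_true]; exact hpe
  · simp only [he, if_false]; exact continuous_const.sub hpe

/-- `p ↦ N(p; H, f, g)` is continuous on `[0,1]^ι`. [this work] -/
theorem continuous_osN (H : Set (Set ι)) (f g : Set ι → ℝ) : Continuous (fun p : ι → unitInterval => osN p H f g) := by
  have key := fun (h : Set ι → ℝ) => continuous_ex_bernoulliWeight (ι := ι) h
  unfold osN osCert
  exact (((key _).mul (key _)).add ((continuous_const.sub (key _)).mul (key _))).sub
    ((((key _).mul (key _)).add ((key _).mul (key _))).sub (((key _).mul (key _)).mul (key _)))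

/-- **From the open cube to the closed cube.**  If `0 ≤ N(q; H, f, g)` for every interior density vector `q ∈ (0,1)^ι`, then
`0 ≤ N(p; H, f, g)` for every `p ∈ [0,1]^ι`. [this work] -/
theorem osN_nonneg_of_forall_interior (H : Set (Set ι)) (f g : Set ι → ℝ)
    (h : ∀ q : ι → unitInterval, (∀ e, 0 < (q e : ℝ) ∧ (q e : ℝ) < 1) → 0 ≤ osN q H f g) (p : ι → unitInterval) :
    0 ≤ osN p H f g := by
  -- the segment `q_s = (1 − s) p + s/2`, clamped to `[0,1]` so that it is defined for every real `s`
  set q : ℝ → ι → unitInterval := fun s e =>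
    ⟨min 1 (max 0 ((1 - s) * (p e : ℝ) + s / 2)), le_min zero_le_one (le_max_left _ _), min_le_left _ _⟩ with hq
  have hqc : Continuous q := by
    refine continuous_pi fun e => Continuous.subtype_mk ?_ _
    exact continuous_const.min (continuous_const.max (((continuous_const.sub continuous_id).mul continuous_const).add
      (continuous_id.div_const _)))
  have hF : Continuous (fun s : ℝ => osN (q s) H f g) := (continuous_osN H f g).comp hqc
  have hint : ∀ s : ℝ, 0 < s → s ≤ 1 → ∀ e, 0 < (q s e : ℝ) ∧ (q s e : ℝ) < 1 := by
    intro s hs0 hs1 e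
    have hp0 : 0 ≤ (p e : ℝ) := (p e).2.1
    have hp1 : (p e : ℝ) ≤ 1 := (p e).2.2
    have hv0 : 0 < (1 - s) * (p e : ℝ) + s / 2 := by nlinarith
    have hv1 : (1 - s) * (p e : ℝ) + s / 2 < 1 := by nlinarith
    have hval : (q s e : ℝ) = (1 - s) * (p e : ℝ) + s / 2 := by
      simp only [hq]
      rw [max_eq_right hv0.le, min_eq_right hv1.le]
    rw [hval]; exact ⟨hv0, hv1⟩
  have hC : IsClosed {s : ℝ | 0 ≤ osN (q s) H f g} := isClosed_le continuous_const hF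
  have hsub : Set.Ioc (0 : ℝ) 1 ⊆ {s : ℝ | 0 ≤ osN (q s) H f g} := fun s hs => h (q s) (hint s hs.1 hs.2)
  have h0 : (0 : ℝ) ∈ closure (Set.Ioc (0 : ℝ) 1) := by
    rw [closure_Ioc zero_ne_one]; exact ⟨le_rfl, zero_le_one⟩
  have h0' : (0 : ℝ) ∈ {s : ℝ | 0 ≤ osN (q s) H f g} := hC.closure_subset_iff.2 hsub h0
  have hq0 : q 0 = p := by
    funext e
    apply Subtype.ext
    simp only [hq, sub_zero, one_mul, zero_div, add_zero]
    rw [max_eq_right (p e).2.1, min_eq_right (p e).2.2]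
  rw [Set.mem_setOf_eq, hq0] at h0'
  exact h0'

end SahiOneStep

end Summit.CriticalPhenomena.PercolationContinuityZ3.Theorems
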